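import Summits.RiemannHypothesis.RiemannHypothesis.Theorems.GroundBartaPolarPerronFrobeniusThetaWindowCollarArch
import Literature.NumberTheory.LFunctions.WeilGroundEnergyParitySplit
import HarnessLib

/-!
# The theta quasimode law: `ε(a) ≤ ε_ev(a) ≤ C x^{2π - 5/4} e^{-πx}`, `x = e^{2a}` (RH-free)

The smooth theta window vector `Θ_a = Φ χ_a` (`GroundBartaPolarPerronFrobeniusThetaWindowTest`) is an
even Weil test supported in `[-a, a]`, equal to `Φ` on the bulk `|t| ≤ a - e^{-2a}`.  Its energy is a
collar quantity: by the translate identity and Weil-harmonicity of Riemann's kernel,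
`Q(Θ_a) = ∫ Θ_a(u) conj W(τ_u Θ_a) du = -∫ Θ_a(u) conj W(τ_u κ_a) du`, and the collar estimate
`‖W(τ_u κ_a)‖ ≤ C x^{9/4+β} e^{-πx}` (`|u| ≤ a`, `a ≥ 2`, `β = 2π - 9/2`;
`exists_weilFunctional_translate_collarTail_le`) gives `|Q(Θ_a)| ≤ 2aΦ(0) · C x^{9/4+β} e^{-πx}`.
Since `‖Θ_a‖₂² ≥ ∫_{[-1,1]} Φ² ≥ 2 (min_{[-1,1]} Φ)² > 0`, the homogeneous variational inequality
`ε_ev(a) ‖Θ_a‖₂² ≤ Re Q(Θ_a)` yields the **theta quasimode law**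

  `ε(a) ≤ ε_ev(a) ≤ C' x^{2π - 5/4} e^{-π x}`  for all `a ≥ 2`.

This makes the constant in the tree's `weilGroundEnergy_exp_exp_decay` (`∃ c > 0`, unnamed) explicit:
any `c < π` works, and `c = π` up to the power `x^{2π-5/4}`; it is the upper half of Connes's law with
`π` in place of the conjectured `4π` (`ConnesLawUpper`), obtained from the theta vector instead of the
prolate vector.  No hypothesis on the zeros of `ζ` enters.
-/

set_option linter.dupNamespace false

noncomputable section

open Set MeasureTheory Filter Complex
open scoped Real Topology ComplexConjugate

namespace Summit.RiemannHypothesis.RiemannHypothesis.Theorems.PolarPerronFrobenius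

open Literature.NumberTheory.LFunctions

/-- The smooth theta window vector `Θ_a = Φ χ_a`, complexified, in the spelling of the route files. -/
local notation "Θ[" a "]" => (fun t : ℝ =>
  ((weilThetaPhi t * Real.smoothTransition ((a - t) * Real.exp (2 * a)) *
    Real.smoothTransition ((a + t) * Real.exp (2 * a)) : ℝ) : ℂ))

/-- The collar tail `κ_a = Φ (1 - χ_a)`, complexified. -/
local notation "κ[" a "]" => (fun t : ℝ =>
  ((weilThetaPhi t * (1 - Real.smoothTransition ((a - t) * Real.exp (2 * a)) *
    Real.smoothTransition ((a + t) * Real.exp (2 * a))) : ℝ) : ℂ))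

/-- **The energy of the theta window vector is super-exponentially small**: with the collar constant
`C` of `exists_weilFunctional_translate_collarTail_le`,
`‖Q(Θ_a)‖ ≤ 2a Φ(0) · C x^{9/4+β} e^{-πx}` for `a ≥ 2` (`x = e^{2a}`, `β = 2π - 9/2`). [folklore] -/
theorem norm_weilQuadratic_thetaWin_le :
    ∃ C : ℝ, 0 ≤ C ∧ ∀ a : ℝ, 2 ≤ a →
      ‖weilQuadratic Θ[a]‖ ≤
        2 * a * weilThetaPhi 0 * (C * rexp (2 * a) ^ (9 / 4 + (2 * π - 9 / 2)) *
          rexp (-(π * rexp (2 * a)))) := by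
  obtain ⟨C, hC, hB⟩ := exists_weilFunctional_translate_collarTail_le
  refine ⟨C, hC, fun a ha => ?_⟩
  have ha0 : 0 < a := by linarith
  set B : ℝ := C * rexp (2 * a) ^ (9 / 4 + (2 * π - 9 / 2)) * rexp (-(π * rexp (2 * a))) with hBdef
  have hB0 : 0 ≤ B := by positivity
  have hΦ0 : 0 ≤ weilThetaPhi 0 := (weilThetaPhi_pos 0).le
  -- `Q(Θ_a) = ∫ Θ_a(u) conj W(τ_u Θ_a) du`
  have hQ : weilQuadratic Θ[a] = ∫ u, Θ[a] u * conj (weilFunctional (fun t => Θ[a] (t + u))) :=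
    thetaWin_windowImage (thetaWin_isWeilTest a) a
  rw [hQ]
  -- pointwise bound by the indicator of the window
  have hpt : ∀ u : ℝ, ‖Θ[a] u * conj (weilFunctional (fun t => Θ[a] (t + u)))‖ ≤
      (Ioo (-a) a).indicator (fun _ => weilThetaPhi 0 * B) u := by
    intro u
    by_cases hu : u ∈ Ioo (-a) a
    · rw [indicator_of_mem hu, norm_mul, Complex.norm_conj, weilFunctional_translate_thetaWin,
        norm_neg]
      exact mul_le_mul (norm_thetaWin_le a u) (hB a ha u (abs_le.2 ⟨hu.1.le, hu.2.le⟩))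
        (norm_nonneg _) hΦ0
    · rw [indicator_of_notMem hu, thetaWin_eq_zero hu, zero_mul, norm_zero]
  have hint : Integrable (fun u : ℝ => (Ioo (-a) a).indicator (fun _ => weilThetaPhi 0 * B) u) :=
    (integrableOn_const (by simp [Real.volume_Ioo])).integrable_indicator measurableSet_Ioo
  calc ‖∫ u, Θ[a] u * conj (weilFunctional (fun t => Θ[a] (t + u)))‖
      ≤ ∫ u, (Ioo (-a) a).indicator (fun _ => weilThetaPhi 0 * B) u :=
        norm_integral_le_of_norm_le hint (Eventually.of_forall hpt)
    _ = 2 * a * weilThetaPhi 0 * B := by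
        rw [integral_indicator_const _ measurableSet_Ioo, Real.volume_real_Ioo, smul_eq_mul,
          max_eq_left (by linarith)]
        ring

/-- **A uniform lower bound on the mass of the theta window vector**: for `a ≥ 2` the plateau contains
`[-1, 1]`, where `Θ_a = Φ ≥ min_{[-1,1]} Φ > 0`, so `∫ ‖Θ_a‖² ≥ m` for some `m > 0` independent of
`a`. [folklore] -/
theorem exists_integral_norm_sq_thetaWin_ge :
    ∃ m : ℝ, 0 < m ∧ ∀ a : ℝ, 2 ≤ a → m ≤ ∫ t, ‖Θ[a] t‖ ^ 2 := by
  -- minimum of `Φ` on `[-1, 1]`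
  obtain ⟨t₀, ht₀, hmin⟩ := (isCompact_Icc : IsCompact (Icc (-1 : ℝ) 1)).exists_isMinOn
    (nonempty_Icc.2 (by norm_num)) continuous_weilThetaPhi.continuousOn
  set m₀ : ℝ := weilThetaPhi t₀ with hm₀
  have hm₀pos : 0 < m₀ := weilThetaPhi_pos t₀
  refine ⟨2 * m₀ ^ 2, by positivity, fun a ha => ?_⟩
  have hplateau : ∀ t ∈ Icc (-1 : ℝ) 1, Θ[a] t = ((weilThetaPhi t : ℝ) : ℂ) := by
    intro t ht
    refine thetaWin_eq_phi ?_
    have h4 : rexp (-(2 * a)) ≤ 1 := by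
      rw [Real.exp_le_one_iff]; linarith
    have := abs_le.2 ⟨ht.1, ht.2⟩
    linarith
  have hpt : ∀ t : ℝ, (Icc (-1 : ℝ) 1).indicator (fun _ => m₀ ^ 2) t ≤ ‖Θ[a] t‖ ^ 2 := by
    intro t
    by_cases ht : t ∈ Icc (-1 : ℝ) 1
    · rw [indicator_of_mem ht, hplateau t ht, Complex.norm_real, Real.norm_eq_abs,
        abs_of_pos (weilThetaPhi_pos t)]
      exact pow_le_pow_left₀ hm₀pos.le (hmin ht) 2
    · rw [indicator_of_notMem ht]; positivity
  calc 2 * m₀ ^ 2 = ∫ t, (Icc (-1 : ℝ) 1).indicator (fun _ => m₀ ^ 2) t := by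
        rw [integral_indicator_const _ measurableSet_Icc, Real.volume_real_Icc, smul_eq_mul,
          max_eq_left (by norm_num)]
        ring
    _ ≤ ∫ t, ‖Θ[a] t‖ ^ 2 :=
        integral_mono ((integrableOn_const (by simp [Real.volume_Icc])).integrable_indicator
          measurableSet_Icc) (thetaWin_isWeilTest a).integrable_norm_sq hpt

/-- **THE THETA QUASIMODE LAW (even sector).**  There is `C` such that for all `a ≥ 2`

  `ε_ev(a) ≤ C · x^{2π - 5/4} · e^{-π x}`,  `x = e^{2a}`:

the bottom of Weil's form on even window tests decays at least like `e^{-π e^{2a}}` — unconditionally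
(no input on the zeros of `ζ`), with the explicit rate `π` furnished by the theta vector
`Θ_a = Φ χ_a` and the collar estimate of the GroundBarta theta-vector toolkit. [folklore] -/
theorem weilEvenGroundEnergy_le_thetaQuasimode :
    ∃ C : ℝ, 0 ≤ C ∧ ∀ a : ℝ, 2 ≤ a →
      weilEvenGroundEnergy a ≤ C * rexp (2 * a) ^ (2 * π - 5 / 4) * rexp (-(π * rexp (2 * a))) := by
  obtain ⟨C, hC, hQ⟩ := norm_weilQuadratic_thetaWin_le
  obtain ⟨m, hm, hmass⟩ := exists_integral_norm_sq_thetaWin_ge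
  have hΦ0' : 0 ≤ weilThetaPhi 0 := (weilThetaPhi_pos 0).le
  refine ⟨2 * weilThetaPhi 0 * C / m, by positivity, fun a ha => ?_⟩
  have ha0 : 0 < a := by linarith
  set x : ℝ := rexp (2 * a) with hx
  have hx0 : 0 < x := Real.exp_pos _
  have hax : a ≤ x := by
    have := Real.add_one_le_exp (2 * a)
    rw [hx]; linarith
  have hΦ0 : 0 ≤ weilThetaPhi 0 := (weilThetaPhi_pos 0).le
  set R : ℝ := rexp (-(π * x)) with hR
  have hR0 : 0 < R := Real.exp_pos _
  -- variational inequality on the (un-normalised) theta vector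
  have hvar : weilEvenGroundEnergy a * ∫ t, ‖Θ[a] t‖ ^ 2 ≤ (weilQuadratic Θ[a]).re :=
    weilEvenGroundEnergy_mul_le_re (thetaWin_isWeilTest a) (thetaWin_tsupport a) (thetaWin_even a)
  have hre : (weilQuadratic Θ[a]).re ≤ 2 * a * weilThetaPhi 0 * (C * x ^ (9 / 4 + (2 * π - 9 / 2)) * R) :=
    ((le_abs_self _).trans (Complex.abs_re_le_norm _)).trans (hQ a ha)
  have hM := hmass a ha
  have hMpos : 0 < ∫ t, ‖Θ[a] t‖ ^ 2 := hm.trans_le hM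
  -- `ε_ev(a) ≤ (2aΦ(0) C x^{9/4+β} R) / ∫‖Θ_a‖² ≤ (2aΦ(0) C x^{9/4+β} R) / m`
  have hnum0 : 0 ≤ 2 * a * weilThetaPhi 0 * (C * x ^ (9 / 4 + (2 * π - 9 / 2)) * R) := by positivity
  have h1 : weilEvenGroundEnergy a ≤ 2 * a * weilThetaPhi 0 * (C * x ^ (9 / 4 + (2 * π - 9 / 2)) * R) / m := by
    rw [le_div_iff₀ hm]
    rcases le_or_gt 0 (weilEvenGroundEnergy a) with hε | hε
    · exact (mul_le_mul_of_nonneg_left hM hε).trans (hvar.trans hre)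
    · exact (mul_nonpos_of_nonpos_of_nonneg hε.le hm.le).trans hnum0
  -- absorb `2a ≤ 2x` into the power: `a · x^{9/4+β} ≤ x^{13/4+β} = x^{2π-5/4}`
  have hpow : a * x ^ (9 / 4 + (2 * π - 9 / 2)) ≤ x ^ (2 * π - 5 / 4) := by
    have : x ^ (2 * π - 5 / 4) = x * x ^ (9 / 4 + (2 * π - 9 / 2)) := by
      rw [show (2 * π - 5 / 4 : ℝ) = 1 + (9 / 4 + (2 * π - 9 / 2)) by ring,
        Real.rpow_add hx0, Real.rpow_one]
    rw [this]
    exact mul_le_mul_of_nonneg_right hax (by positivity)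
  calc weilEvenGroundEnergy a
      ≤ 2 * a * weilThetaPhi 0 * (C * x ^ (9 / 4 + (2 * π - 9 / 2)) * R) / m := h1
    _ = (2 * weilThetaPhi 0 * C / m) * (a * x ^ (9 / 4 + (2 * π - 9 / 2))) * R := by
        field_simp
    _ ≤ (2 * weilThetaPhi 0 * C / m) * x ^ (2 * π - 5 / 4) * R := by
        have h0 : 0 ≤ 2 * weilThetaPhi 0 * C / m := by positivity
        exact mul_le_mul_of_nonneg_right (mul_le_mul_of_nonneg_left hpow h0) hR0.le

/-- **THE THETA QUASIMODE LAW (full form).**  `ε(a) ≤ C x^{2π - 5/4} e^{-πx}` for all `a ≥ 2`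
(`x = e^{2a}`): the bottom of Weil's windowed form decays at least like `e^{-π e^{2a}}`, with the
explicit rate `π` — the un-named rate `c > 0` of `weilGroundEnergy_exp_exp_decay` made explicit,
unconditionally (compare the conjectured `4π` of `ConnesLawUpper`). [folklore] -/
theorem weilGroundEnergy_le_thetaQuasimode :
    ∃ C : ℝ, 0 ≤ C ∧ ∀ a : ℝ, 2 ≤ a →
      weilGroundEnergy a ≤ C * rexp (2 * a) ^ (2 * π - 5 / 4) * rexp (-(π * rexp (2 * a))) := by
  obtain ⟨C, hC, h⟩ := weilEvenGroundEnergy_le_thetaQuasimode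
  exact ⟨C, hC, fun a ha => (weilGroundEnergy_le_weilEvenGroundEnergy a).trans (h a ha)⟩

/-- **Rate form**: for every `c < π` there is `a₀` with `ε_ev(a) ≤ e^{-c e^{2a}}` for all `a ≥ a₀`
(the polynomial factor is absorbed by the slack `π - c` in the double exponential). [folklore] -/
theorem weilEvenGroundEnergy_le_exp_neg_mul_exp {c : ℝ} (hc : c < π) :
    ∃ a₀ : ℝ, ∀ a : ℝ, a₀ ≤ a → weilEvenGroundEnergy a ≤ rexp (-(c * rexp (2 * a))) := by
  obtain ⟨C, hC, h⟩ := weilEvenGroundEnergy_le_thetaQuasimode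
  -- `C x^q e^{-πx} ≤ e^{-cx}` as soon as `C x^q ≤ e^{(π - c) x}`, which holds for large `x`
  set q : ℝ := 2 * π - 5 / 4 with hq
  have hq0 : 0 < q := by rw [hq]; linarith [Real.pi_gt_three]
  have hπc : 0 < π - c := by linarith
  -- `x^q / e^{(π-c)x} → 0`
  have hlim : Tendsto (fun x : ℝ => C * x ^ q * rexp (-((π - c) * x))) atTop (nhds 0) := by
    have h1 := (tendsto_rpow_mul_exp_neg_mul_atTop_nhds_zero q (π - c) hπc).const_mul C
    rw [mul_zero] at h1
    refine h1.congr' (Eventually.of_forall fun x => ?_)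
    simp only; ring_nf
  have hev : ∀ᶠ x : ℝ in atTop, C * x ^ q * rexp (-((π - c) * x)) ≤ 1 :=
    (hlim.eventually (ge_mem_nhds zero_lt_one))
  obtain ⟨X, hX⟩ := eventually_atTop.1 hev
  -- choose `a₀ ≥ 2` with `e^{2a₀} ≥ X`
  refine ⟨max 2 (|X| / 2 + 1), fun a ha => ?_⟩
  have ha2 : 2 ≤ a := (le_max_left _ _).trans ha
  have haX : |X| / 2 + 1 ≤ a := (le_max_right _ _).trans ha
  set x : ℝ := rexp (2 * a) with hx
  have hxX : X ≤ x := by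
    have h1 : X ≤ |X| := le_abs_self X
    have h2 : 2 * a ≤ x := by have := Real.add_one_le_exp (2 * a); rw [hx]; linarith
    linarith
  have hx0 : 0 < x := Real.exp_pos _
  have hb := hX x hxX
  calc weilEvenGroundEnergy a ≤ C * x ^ q * rexp (-(π * x)) := h a ha2
    _ = (C * x ^ q * rexp (-((π - c) * x))) * rexp (-(c * x)) := by
        rw [mul_assoc (C * x ^ q), ← Real.exp_add]; congr 1; ring_nf
    _ ≤ 1 * rexp (-(c * x)) := mul_le_mul_of_nonneg_right hb (Real.exp_pos _).le
    _ = rexp (-(c * x)) := one_mul _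

end Summit.RiemannHypothesis.RiemannHypothesis.Theorems.PolarPerronFrobenius

end
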